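import Literature.Geometry.DiscreteGeometry.KissingArccosBrackets
import HarnessLib

/-!
# Kertész 1994 — the certified azimuth budget (kernel-evaluable branch and bound)

Topic `Literature/Geometry/DiscreteGeometry`; fifth provefact instalment for the named fact
`kertesz1994_ninePointsHemisphere` (`KerteszNinePointsHemisphere.lean`): the NUMERIC half of the
azimuth-budget proof (cell record HOME/cf-lit/kertesz/BLUEPRINT.md of
`run/shared/lean/pub/crystal3d-full`).  The three northern points of a nine-point one-sided
arrangement have heights `w₁, w₂, w₃ ∈ (1/2, 1)`; about the pole they cut the circle of azimuths into
three sectors of extents `Φ₁ + Φ₂ + Φ₃ = 2π` containing `m₁, m₂, m₃` low points (`Σ m = 6`).  The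
height-free pair bounds of `KerteszNorthernPoints.lean` (`D(w) = arccos (1/(2r))` high–low,
`G = arccos √(1/3)` low–low, `A(w, w') = arccos ((1/2 − ww')/(r r'))` high–high, `r = √(1 − w²)`)
bound every arc of the circle from below (`KerteszAzimuthArcs.lean`): these are the hypotheses
`CrudeHyps`.  This file decides them by an exact-rational branch and bound over boxes of
`(w₁, w₂, w₃)`, evaluated once BY THE KERNEL (`decide +kernel`, standard axioms only — the first
version, p747860, ran the same Boolean by `native_decide`), with soundness proved over the reals:

* Part A — rational lower bounds: `dLo` (for `D`, via `KissingLP.ladderSqrtDown`), `aVal` (for `A`,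
  sign-split, via `ladderSqrtDown` / `π − ladderSqrtUp`) and `aInf` (the box forces
  `(1/2 − ww')/(r r') < −1`), constants `G0 = 0.9552 ≤ G`, `PI3 = 1.0471 ≤ π/3`,
  `TWOPIHI = 6.2832 > 2π`;
* Part B — the covers: `crudeViolated` (the seven cover sums of BLUEPRINT §1: three-visited,
  three two-visited, three one-visited) and `sixtyViolated` (pattern `(2,2,2)` with in-sector gaps
  `π/3`, justified by `KerteszLiftPenalty.lean`); `bnbCrude`, `bnbSixty` (split the widest side at
  its midpoint, fuel = depth);
* Part C — the run `allChecks_eq_true`, by kernel evaluation (`decide +kernel`) split into pieces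
  of at most ~45 s of kernel time each (the 27 compositions; the two halves of each of the six
  window boxes; the two halves of the `z = 0` window), reassembled by `simp only`;
* Part D — soundness over the reals (`dLo_le`, `aVal_le`, `aInf_sound`, `bnbCrude_sound`,
  `bnbSixty_sound`) and the consequences **`crude_pattern`** (every composition other than
  `(2,2,2)` contradicts `CrudeHyps`), **`crude_window`** (under `CrudeHyps 2 2 2` every
  `w_j ∈ (0.78, 0.84)`), **`sixty_cube`** (under `SixtyHyps`, every `w_j ∈ [0.8138, 0.8192]` — the
  cube of `KerteszLocalRigidity.lean`).

A Python twin (HOME/cf-lit/kertesz/cert_bnb.py, same step `2⁻¹³`, same brackets) certifies the same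
claims with 552 + 35 + 299 + 294 boxes.  TRUST BASE: the Lean kernel on the standard axioms
(`propext`, `Classical.choice`, `Quot.sound`) — no `Lean.ofReduceBool`; hence the discharge
`kertesz1994_ninePointsHemisphere_holds` (`KerteszNinePointsHemisphereHolds.lean`), whose only
non-standard ingredient was this run, is on the standard axioms too.  WHAT THIS IS NOT: the discharge
itself (the geometric derivation of `CrudeHyps` / `SixtyHyps` and the assembly are in the later files).

## References
* G. Kertész, *Nine points on the hemisphere*, Colloq. Math. Soc. János Bolyai 63 (1994) 189–196;
  Zbl 0822.52005. [`Kertesz1994`]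
* R. E. Moore, *Interval Analysis* (1966), §3 (inclusion property). [`Moore1966`]
-/

namespace Literature.Geometry.DiscreteGeometry

namespace KerteszCert

open KissingLP Real

/-! ### Part A. Rational lower bounds for the pair angles -/

/-- Ladder step `2⁻¹³`. [folklore] -/
def δ : ℚ := 1 / 8192

/-- Ladder length: `NLAD · δ = 3.1416015625 ≥ 3.1416`. [folklore] -/
def NLAD : ℕ := 25736

/-- `0.9552 ≤ arccos √(1/3)` (the low–low gap). [folklore] -/
def G0 : ℚ := 9552 / 10000

/-- `1.0471 ≤ π/3`. [folklore] -/
def PI3 : ℚ := 10471 / 10000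

/-- `3.1415 ≤ π`. [folklore] -/
def PILO : ℚ := 31415 / 10000

/-- `2π ≤ 6.2832`. [folklore] -/
def TWOPIHI : ℚ := 62832 / 10000

/-- **Lower bound for `D(w) = arccos (1/(2 √(1 − w²)))`** valid for all `0 ≤ w ≤ whi`:
`arccos √(1/(4 (1 − whi²)))` laddered down (`0` if `whi² ≥ 1`). [cite: Moore1966, §3] -/
def dLo (whi : ℚ) : ℚ :=
  if 1 ≤ whi ^ 2 then 0 else (ladderSqrtDown δ NLAD (1 / (4 * (1 - whi ^ 2))) : ℚ) * δ

/-- `n_hi = 1/2 − lj lk ≥ 1/2 − ww'` on the box. [folklore] -/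
def nHi (lj lk : ℚ) : ℚ := 1 / 2 - lj * lk

/-- `d2_hi = (1 − lj²)(1 − lk²) ≥ (r r')²` on the box. [folklore] -/
def d2Hi (lj lk : ℚ) : ℚ := (1 - lj ^ 2) * (1 - lk ^ 2)

/-- `d2_lo = (1 − hj²)(1 − hk²) ≤ (r r')²` on the box. [folklore] -/
def d2Lo (hj hk : ℚ) : ℚ := (1 - hj ^ 2) * (1 - hk ^ 2)

/-- **The box forces `(1/2 − ww')/(r r') < −1`** (no such pair of northern points).
[cite: Moore1966, §3] -/
def aInf (lj lk : ℚ) : Bool :=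
  decide (0 ≤ lj) && decide (0 ≤ lk) && decide (nHi lj lk < 0) && decide (0 < d2Hi lj lk) &&
    decide (d2Hi lj lk < nHi lj lk ^ 2)

/-- **Lower bound for `A(w, w') = arccos ((1/2 − ww')/(r r'))`** over `[lj, hj] × [lk, hk]`:
if `n_hi ≤ 0` (and `n_hi² ≤ d2_hi`) the cosine is `≤ −√(n_hi²/d2_hi)`, so
`A ≥ π − arccos √(n_hi²/d2_hi)`; if `n_hi > 0` (and the upper ends are `≤ 1`) it is
`≤ √(n_hi²/d2_lo)`. [cite: Moore1966, §3] -/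
def aVal (lj hj lk hk : ℚ) : ℚ :=
  if 0 ≤ lj ∧ 0 ≤ lk ∧ nHi lj lk ≤ 0 ∧ 0 < d2Hi lj lk ∧ nHi lj lk ^ 2 ≤ d2Hi lj lk then
    PILO - (ladderSqrtUp δ NLAD (nHi lj lk ^ 2 / d2Hi lj lk) : ℚ) * δ
  else if 0 ≤ lj ∧ 0 ≤ lk ∧ 0 < nHi lj lk ∧ hj ≤ 1 ∧ hk ≤ 1 ∧ 0 < d2Lo hj hk then
    (ladderSqrtDown δ NLAD (nHi lj lk ^ 2 / d2Lo hj hk) : ℚ) * δ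
  else 0

/-- The walk through an arc with `m` low points: `0` if `m = 0`, else `Da + Db + (m − 1) g`.
[folklore] -/
def walk (Da Db : ℚ) (m : ℕ) (g : ℚ) : ℚ := if m = 0 then 0 else Da + Db + ((m - 1 : ℕ) : ℚ) * g

/-! ### Part B. Boxes, covers, branch and bound -/

/-- A box (interval vector) of northern heights `[l1, h1] × [l2, h2] × [l3, h3]`.
[cite: Moore1966, §3 (interval vectors)] -/
structure Box where
  /-- lower end for `w₁` -/
  l1 : ℚ
  /-- upper end for `w₁` -/
  h1 : ℚ
  /-- lower end for `w₂` -/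
  l2 : ℚ
  /-- upper end for `w₂` -/
  h2 : ℚ
  /-- lower end for `w₃` -/
  l3 : ℚ
  /-- upper end for `w₃` -/
  h3 : ℚ

/-- Split the widest side at its midpoint (first widest, as in the Python twin). [folklore] -/
def Box.split (b : Box) : Box × Box :=
  if b.h2 - b.l2 ≤ b.h1 - b.l1 ∧ b.h3 - b.l3 ≤ b.h1 - b.l1 then
    ({ b with h1 := (b.l1 + b.h1) / 2 }, { b with l1 := (b.l1 + b.h1) / 2 })
  else if b.h3 - b.l3 ≤ b.h2 - b.l2 then
    ({ b with h2 := (b.l2 + b.h2) / 2 }, { b with l2 := (b.l2 + b.h2) / 2 })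
  else
    ({ b with h3 := (b.l3 + b.h3) / 2 }, { b with l3 := (b.l3 + b.h3) / 2 })

/-- Certified lower bounds of the three `D`'s and three `A`'s on a box. [folklore] -/
def Box.D1 (b : Box) : ℚ := dLo b.h1
/-- see `Box.D1`. [folklore] -/
def Box.D2 (b : Box) : ℚ := dLo b.h2
/-- see `Box.D1`. [folklore] -/
def Box.D3 (b : Box) : ℚ := dLo b.h3
/-- see `Box.D1`. [folklore] -/
def Box.A12 (b : Box) : ℚ := aVal b.l1 b.h1 b.l2 b.h2
/-- see `Box.D1`. [folklore] -/
def Box.A23 (b : Box) : ℚ := aVal b.l2 b.h2 b.l3 b.h3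
/-- see `Box.D1`. [folklore] -/
def Box.A31 (b : Box) : ℚ := aVal b.l3 b.h3 b.l1 b.h1

/-- Some high–high pair is infeasible on the box. [folklore] -/
def Box.infeasible (b : Box) : Bool := aInf b.l1 b.l2 || aInf b.l2 b.l3 || aInf b.l3 b.l1

/-- Sector bound: jump or walk. [folklore] -/
def Box.S1 (b : Box) (m1 : ℕ) : ℚ := max b.A12 (walk b.D1 b.D2 m1 G0)
/-- see `Box.S1`. [folklore] -/
def Box.S2 (b : Box) (m2 : ℕ) : ℚ := max b.A23 (walk b.D2 b.D3 m2 G0)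
/-- see `Box.S1`. [folklore] -/
def Box.S3 (b : Box) (m3 : ℕ) : ℚ := max b.A31 (walk b.D3 b.D1 m3 G0)

/-- The seven crude cover sums. [cite: Kertesz1994, proof (relative longitudes)] -/
def Box.T3 (b : Box) (m1 m2 m3 : ℕ) : ℚ := b.S1 m1 + b.S2 m2 + b.S3 m3
/-- see `Box.T3`. [folklore] -/
def Box.T12 (b : Box) (m1 m2 m3 : ℕ) : ℚ := b.S1 m1 + max b.A12 (walk b.D2 b.D1 (m2 + m3) G0)
/-- see `Box.T3`. [folklore] -/
def Box.T23 (b : Box) (m1 m2 m3 : ℕ) : ℚ := b.S2 m2 + max b.A23 (walk b.D3 b.D2 (m3 + m1) G0)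
/-- see `Box.T3`. [folklore] -/
def Box.T31 (b : Box) (m1 m2 m3 : ℕ) : ℚ := b.S3 m3 + max b.A31 (walk b.D1 b.D3 (m1 + m2) G0)
/-- see `Box.T3`. [folklore] -/
def Box.O1 (b : Box) : ℚ := 2 * b.D1 + 5 * G0
/-- see `Box.T3`. [folklore] -/
def Box.O2 (b : Box) : ℚ := 2 * b.D2 + 5 * G0
/-- see `Box.T3`. [folklore] -/
def Box.O3 (b : Box) : ℚ := 2 * b.D3 + 5 * G0

/-- **The crude covers are violated on the box** (composition `(m₁, m₂, m₃)`).
[cite: Kertesz1994, proof (relative longitudes)] -/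
def crudeViolated (m1 m2 m3 : ℕ) (b : Box) : Bool :=
  b.infeasible || decide (TWOPIHI < b.T3 m1 m2 m3) || decide (TWOPIHI < b.T12 m1 m2 m3) ||
    decide (TWOPIHI < b.T23 m1 m2 m3) || decide (TWOPIHI < b.T31 m1 m2 m3) ||
    decide (TWOPIHI < b.O1) || decide (TWOPIHI < b.O2) || decide (TWOPIHI < b.O3)

/-- The `z = 0` three-sector sum for pattern `(2,2,2)`. [folklore] -/
def Box.T60 (b : Box) : ℚ :=
  max b.A12 (b.D1 + b.D2 + PI3) + max b.A23 (b.D2 + b.D3 + PI3) + max b.A31 (b.D3 + b.D1 + PI3)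

/-- **The `z = 0` sector covers are violated on the box**. [cite: Kertesz1994, proof] -/
def sixtyViolated (b : Box) : Bool := b.infeasible || decide (TWOPIHI < b.T60)

/-- The cube of `KerteszLocalRigidity.lean`: `0.8138 ≤ w_j ≤ 0.8192`. [folklore] -/
def Box.inCube (b : Box) : Bool :=
  decide (8138 / 10000 ≤ b.l1) && decide (b.h1 ≤ 8192 / 10000) &&
  decide (8138 / 10000 ≤ b.l2) && decide (b.h2 ≤ 8192 / 10000) &&
  decide (8138 / 10000 ≤ b.l3) && decide (b.h3 ≤ 8192 / 10000)

/-- Branch and bound for the crude budget (fuel = depth). [folklore] -/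
def bnbCrude (m1 m2 m3 : ℕ) : ℕ → Box → Bool
  | 0, _ => false
  | fuel + 1, b =>
    crudeViolated m1 m2 m3 b ||
      (bnbCrude m1 m2 m3 fuel b.split.1 && bnbCrude m1 m2 m3 fuel b.split.2)

/-- Branch and bound for the `z = 0` budget outside the cube (fuel = depth). [folklore] -/
def bnbSixty : ℕ → Box → Bool
  | 0, _ => false
  | fuel + 1, b =>
    b.inCube || sixtyViolated b || (bnbSixty fuel b.split.1 && bnbSixty fuel b.split.2)

/-! ### Part C. The runs -/

/-- The whole box of northern heights `[1/2, 1]³`. [folklore] -/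
def root : Box := ⟨1 / 2, 1, 1 / 2, 1, 1 / 2, 1⟩

/-- The compositions of `6` into three parts other than `(2,2,2)`. [folklore] -/
def compositions : List (ℕ × ℕ × ℕ) :=
  ((List.range 7).flatMap fun m1 => (List.range (7 - m1)).map fun m2 => (m1, m2, 6 - m1 - m2)).filter
    fun t => t ≠ (2, 2, 2)

/-- The six complementary window boxes for `(2,2,2)`: `w_j ≤ 0.78` or `w_j ≥ 0.84`. [folklore] -/
def windowBoxes : List Box :=
  [⟨1 / 2, 78 / 100, 1 / 2, 1, 1 / 2, 1⟩, ⟨84 / 100, 1, 1 / 2, 1, 1 / 2, 1⟩,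
   ⟨1 / 2, 1, 1 / 2, 78 / 100, 1 / 2, 1⟩, ⟨1 / 2, 1, 84 / 100, 1, 1 / 2, 1⟩,
   ⟨1 / 2, 1, 1 / 2, 1, 1 / 2, 78 / 100⟩, ⟨1 / 2, 1, 1 / 2, 1, 84 / 100, 1⟩]

/-- The window box `[0.78, 0.84]³`. [folklore] -/
def windowBox : Box := ⟨78 / 100, 84 / 100, 78 / 100, 84 / 100, 78 / 100, 84 / 100⟩

/-- All certificates: the 27 compositions, the six window boxes, the cube. [folklore] -/
def allChecks : Bool :=
  (compositions.all fun t => bnbCrude t.1 t.2.1 t.2.2 40 root) &&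
    (windowBoxes.all fun b => bnbCrude 2 2 2 40 b) && bnbSixty 40 windowBox

/-! #### The run, evaluated by the kernel

Every piece below is the SAME Boolean computation the first version ran by `native_decide`, now
reduced by the kernel (`decide +kernel`): exact rational arithmetic on the `2⁻¹³`-ladders of
`KissingArccosBrackets.lean`.  One branch-and-bound call costs the kernel roughly `0.2 s` per visited
box, so the run is cut into pieces of at most a few hundred boxes (one split of each window box =
the two recursive calls at fuel `39`), each its own declaration, and reassembled syntactically. -/

/-- One step of `bnbCrude` from its two halves. [folklore] -/
private theorem bnbCrude_of_split {m1 m2 m3 fuel : ℕ} {b : Box}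
    (h1 : bnbCrude m1 m2 m3 fuel b.split.1 = true) (h2 : bnbCrude m1 m2 m3 fuel b.split.2 = true) :
    bnbCrude m1 m2 m3 (fuel + 1) b = true := by
  simp [bnbCrude, h1, h2]

/-- One step of `bnbSixty` from its two halves. [folklore] -/
private theorem bnbSixty_of_split {fuel : ℕ} {b : Box}
    (h1 : bnbSixty fuel b.split.1 = true) (h2 : bnbSixty fuel b.split.2 = true) :
    bnbSixty (fuel + 1) b = true := by
  simp [bnbSixty, h1, h2]

/-- The 27 compositions other than `(2,2,2)` on the root box (kernel). [folklore] -/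
private theorem run_comps :
    (compositions.all fun t => bnbCrude t.1 t.2.1 t.2.2 40 root) = true := by
  decide +kernel

set_option maxHeartbeats 1000000 in
/-- Window box `w₁ ≤ 0.78`, first half (kernel). [folklore] -/
private theorem run_w0a : bnbCrude 2 2 2 39 (Box.split ⟨1 / 2, 78 / 100, 1 / 2, 1, 1 / 2, 1⟩).1 = true := by
  decide +kernel

set_option maxHeartbeats 1000000 in
/-- Window box `w₁ ≤ 0.78`, second half (kernel). [folklore] -/
private theorem run_w0b : bnbCrude 2 2 2 39 (Box.split ⟨1 / 2, 78 / 100, 1 / 2, 1, 1 / 2, 1⟩).2 = true := by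
  decide +kernel

set_option maxHeartbeats 1000000 in
/-- Window box `w₁ ≥ 0.84`, first half (kernel). [folklore] -/
private theorem run_w1a : bnbCrude 2 2 2 39 (Box.split ⟨84 / 100, 1, 1 / 2, 1, 1 / 2, 1⟩).1 = true := by
  decide +kernel

set_option maxHeartbeats 1000000 in
/-- Window box `w₁ ≥ 0.84`, second half (kernel). [folklore] -/
private theorem run_w1b : bnbCrude 2 2 2 39 (Box.split ⟨84 / 100, 1, 1 / 2, 1, 1 / 2, 1⟩).2 = true := by
  decide +kernel

set_option maxHeartbeats 1000000 in
/-- Window box `w₂ ≤ 0.78`, first half (kernel). [folklore] -/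
private theorem run_w2a : bnbCrude 2 2 2 39 (Box.split ⟨1 / 2, 1, 1 / 2, 78 / 100, 1 / 2, 1⟩).1 = true := by
  decide +kernel

set_option maxHeartbeats 1000000 in
/-- Window box `w₂ ≤ 0.78`, second half (kernel). [folklore] -/
private theorem run_w2b : bnbCrude 2 2 2 39 (Box.split ⟨1 / 2, 1, 1 / 2, 78 / 100, 1 / 2, 1⟩).2 = true := by
  decide +kernel

set_option maxHeartbeats 1000000 in
/-- Window box `w₂ ≥ 0.84`, first half (kernel). [folklore] -/
private theorem run_w3a : bnbCrude 2 2 2 39 (Box.split ⟨1 / 2, 1, 84 / 100, 1, 1 / 2, 1⟩).1 = true := by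
  decide +kernel

set_option maxHeartbeats 1000000 in
/-- Window box `w₂ ≥ 0.84`, second half (kernel). [folklore] -/
private theorem run_w3b : bnbCrude 2 2 2 39 (Box.split ⟨1 / 2, 1, 84 / 100, 1, 1 / 2, 1⟩).2 = true := by
  decide +kernel

set_option maxHeartbeats 1000000 in
/-- Window box `w₃ ≤ 0.78`, first half (kernel). [folklore] -/
private theorem run_w4a : bnbCrude 2 2 2 39 (Box.split ⟨1 / 2, 1, 1 / 2, 1, 1 / 2, 78 / 100⟩).1 = true := by
  decide +kernel

set_option maxHeartbeats 1000000 in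
/-- Window box `w₃ ≤ 0.78`, second half (kernel). [folklore] -/
private theorem run_w4b : bnbCrude 2 2 2 39 (Box.split ⟨1 / 2, 1, 1 / 2, 1, 1 / 2, 78 / 100⟩).2 = true := by
  decide +kernel

set_option maxHeartbeats 1000000 in
/-- Window box `w₃ ≥ 0.84`, first half (kernel). [folklore] -/
private theorem run_w5a : bnbCrude 2 2 2 39 (Box.split ⟨1 / 2, 1, 1 / 2, 1, 84 / 100, 1⟩).1 = true := by
  decide +kernel

set_option maxHeartbeats 1000000 in
/-- Window box `w₃ ≥ 0.84`, second half (kernel). [folklore] -/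
private theorem run_w5b : bnbCrude 2 2 2 39 (Box.split ⟨1 / 2, 1, 1 / 2, 1, 84 / 100, 1⟩).2 = true := by
  decide +kernel

/-- The six window boxes at composition `(2,2,2)` (reassembled). [folklore] -/
private theorem run_windows : (windowBoxes.all fun b => bnbCrude 2 2 2 40 b) = true := by
  simp only [windowBoxes, List.all_cons, List.all_nil, bnbCrude_of_split run_w0a run_w0b,
    bnbCrude_of_split run_w1a run_w1b, bnbCrude_of_split run_w2a run_w2b,
    bnbCrude_of_split run_w3a run_w3b, bnbCrude_of_split run_w4a run_w4b,
    bnbCrude_of_split run_w5a run_w5b, Bool.and_self]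

set_option maxHeartbeats 1000000 in
/-- The `z = 0` budget on the window, first half (kernel). [folklore] -/
private theorem run_sixty_a : bnbSixty 39 (Box.split windowBox).1 = true := by
  decide +kernel

set_option maxHeartbeats 1000000 in
/-- The `z = 0` budget on the window, second half (kernel). [folklore] -/
private theorem run_sixty_b : bnbSixty 39 (Box.split windowBox).2 = true := by
  decide +kernel

/-- **The run** (kernel evaluation, standard axioms; the Python twin certifies the same with
`552 + 35 + 299 + 294` boxes, and the first version ran the same Boolean by `native_decide`).
[cite: Kertesz1994, proof (relative longitudes)] -/
theorem allChecks_eq_true : allChecks = true := by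
  simp only [allChecks, run_comps, run_windows, bnbSixty_of_split run_sixty_a run_sixty_b,
    Bool.and_self]

/-! ### Part D. Soundness over the reals -/

noncomputable section

/-- `D(w) = arccos (1/(2 √(1 − w²)))`: azimuth between a northern point of height `w` and any low
point (`KerteszNorthernPoints.lean`, `mul_cos_le_half_of_high_low`). [cite: Kertesz1994, proof] -/
def Dr (w : ℝ) : ℝ := arccos (1 / (2 * √(1 - w ^ 2)))

/-- The high–high cosine bound `(1/2 − ww')/(r r')`. [cite: Kertesz1994, proof] -/
def cr (w w' : ℝ) : ℝ := (1 / 2 - w * w') / (√(1 - w ^ 2) * √(1 - w' ^ 2))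

/-- `A(w, w') = arccos ((1/2 − ww')/(r r'))`. [cite: Kertesz1994, proof] -/
def Ar (w w' : ℝ) : ℝ := arccos (cr w w')

/-- `G = arccos √(1/3)`, the low–low gap (`cos_le_sqrt_third_of_low_low`). [cite: Musin2006, §2 Thm 2] -/
def Gr : ℝ := arccos √(1 / 3)

/-- Real walk: `0` if `m = 0`, else `Da + Db + (m − 1) g`. [folklore] -/
def walkR (Da Db : ℝ) (m : ℕ) (g : ℝ) : ℝ := if m = 0 then 0 else Da + Db + ((m : ℝ) - 1) * g

/-- Membership of real heights in a box (interval vector). [cite: Moore1966, §3 (interval vectors)] -/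
def Box.mem (b : Box) (w₁ w₂ w₃ : ℝ) : Prop :=
  (b.l1 : ℝ) ≤ w₁ ∧ w₁ ≤ b.h1 ∧ (b.l2 : ℝ) ≤ w₂ ∧ w₂ ≤ b.h2 ∧ (b.l3 : ℝ) ≤ w₃ ∧ w₃ ≤ b.h3

/-- **The crude azimuth budget** of a nine-point arrangement with composition `(m₁, m₂, m₃)`
(sector `1` from `h₁` to `h₂` holds `m₁` low points, etc.): heights in `(1/2, 1)`, sector extents
summing to `2π`, every arc at least its jump bound `A` and its walk bound (height-free `D`'s and
`G`), the full circle at least `2 D_j + 5 G`. [cite: Kertesz1994, proof (relative longitudes)] -/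
structure CrudeHyps (m1 m2 m3 : ℕ) (w₁ w₂ w₃ Φ₁ Φ₂ Φ₃ : ℝ) : Prop where
  hw₁ : 1 / 2 < w₁ ∧ w₁ < 1
  hw₂ : 1 / 2 < w₂ ∧ w₂ < 1
  hw₃ : 1 / 2 < w₃ ∧ w₃ < 1
  hsum : Φ₁ + Φ₂ + Φ₃ = 2 * π
  hc₁₂ : -1 ≤ cr w₁ w₂
  hc₂₃ : -1 ≤ cr w₂ w₃
  hc₃₁ : -1 ≤ cr w₃ w₁
  jump₁ : Ar w₁ w₂ ≤ Φ₁
  jump₂ : Ar w₂ w₃ ≤ Φ₂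
  jump₃ : Ar w₃ w₁ ≤ Φ₃
  jump₁' : Ar w₁ w₂ ≤ Φ₂ + Φ₃
  jump₂' : Ar w₂ w₃ ≤ Φ₃ + Φ₁
  jump₃' : Ar w₃ w₁ ≤ Φ₁ + Φ₂
  walk₁ : walkR (Dr w₁) (Dr w₂) m1 Gr ≤ Φ₁
  walk₂ : walkR (Dr w₂) (Dr w₃) m2 Gr ≤ Φ₂
  walk₃ : walkR (Dr w₃) (Dr w₁) m3 Gr ≤ Φ₃
  walk₁' : walkR (Dr w₂) (Dr w₁) (m2 + m3) Gr ≤ Φ₂ + Φ₃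
  walk₂' : walkR (Dr w₃) (Dr w₂) (m3 + m1) Gr ≤ Φ₃ + Φ₁
  walk₃' : walkR (Dr w₁) (Dr w₃) (m1 + m2) Gr ≤ Φ₁ + Φ₂
  full₁ : 2 * Dr w₁ + 5 * Gr ≤ 2 * π
  full₂ : 2 * Dr w₂ + 5 * Gr ≤ 2 * π
  full₃ : 2 * Dr w₃ + 5 * Gr ≤ 2 * π

/-- **The `z = 0` sector budget** for pattern `(2,2,2)` on the window `[0.78, 0.84]³`: each sector
is at least its jump bound and at least `D_j + D_k + π/3` (the lift penalty dropped).
[cite: Kertesz1994, proof (relative longitudes)] -/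
structure SixtyHyps (w₁ w₂ w₃ Φ₁ Φ₂ Φ₃ : ℝ) : Prop where
  hw₁ : 78 / 100 ≤ w₁ ∧ w₁ ≤ 84 / 100
  hw₂ : 78 / 100 ≤ w₂ ∧ w₂ ≤ 84 / 100
  hw₃ : 78 / 100 ≤ w₃ ∧ w₃ ≤ 84 / 100
  hsum : Φ₁ + Φ₂ + Φ₃ = 2 * π
  hc₁₂ : -1 ≤ cr w₁ w₂
  hc₂₃ : -1 ≤ cr w₂ w₃
  hc₃₁ : -1 ≤ cr w₃ w₁
  jump₁ : Ar w₁ w₂ ≤ Φ₁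
  jump₂ : Ar w₂ w₃ ≤ Φ₂
  jump₃ : Ar w₃ w₁ ≤ Φ₃
  walk₁ : Dr w₁ + Dr w₂ + π / 3 ≤ Φ₁
  walk₂ : Dr w₂ + Dr w₃ + π / 3 ≤ Φ₂
  walk₃ : Dr w₃ + Dr w₁ + π / 3 ≤ Φ₃

/-! #### Constants -/

/-- `G0 ≤ G`. [folklore] -/
private theorem G0_le : ((G0 : ℚ) : ℝ) ≤ Gr := by
  have h := arccos_sqrt_third_bounds.1
  have : ((G0 : ℚ) : ℝ) = 0.9552 := by norm_num [G0]
  rw [this, Gr]; exact h.le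

/-- `PI3 ≤ π/3`. [folklore] -/
private theorem PI3_le : ((PI3 : ℚ) : ℝ) ≤ π / 3 := by
  have : ((PI3 : ℚ) : ℝ) = 1.0471 := by norm_num [PI3]
  rw [this]; linarith [Real.pi_gt_d4]

/-- `PILO ≤ π`. [folklore] -/
private theorem PILO_le : ((PILO : ℚ) : ℝ) ≤ π := by
  have : ((PILO : ℚ) : ℝ) = 3.1415 := by norm_num [PILO]
  rw [this]; linarith [Real.pi_gt_d4]

/-- `2π < TWOPIHI`. [folklore] -/
private theorem two_pi_lt : 2 * π < ((TWOPIHI : ℚ) : ℝ) := by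
  have : ((TWOPIHI : ℚ) : ℝ) = 6.2832 := by norm_num [TWOPIHI]
  rw [this]; linarith [Real.pi_lt_d4]

/-- The side condition of `ladderSqrtUp` holds for our ladder length (`NLAD · δ ≥ 3.1416`).
[folklore] -/
private theorem arccosSqrtLeB_NLAD (r : ℚ) : arccosSqrtLeB r (NLAD * δ) = true := by
  unfold arccosSqrtLeB
  rw [Bool.or_eq_true]
  right
  rw [decide_eq_true_eq]
  norm_num [NLAD, δ]

/-- `Dr ≥ 0`, `Ar ≥ 0`, `Gr ≥ 0`. [folklore] -/
private theorem Dr_nonneg (w : ℝ) : 0 ≤ Dr w := arccos_nonneg _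

/-- see `Dr_nonneg`. [folklore] -/
private theorem Ar_nonneg (w w' : ℝ) : 0 ≤ Ar w w' := arccos_nonneg _

/-- see `Dr_nonneg`. [folklore] -/
private theorem Gr_nonneg : 0 ≤ Gr := arccos_nonneg _

/-! #### Soundness of `dLo`, `aVal`, `aInf`, `walk` -/

/-- **Soundness of `dLo`**: for `0 ≤ w ≤ whi` with `w < 1`, `dLo whi ≤ D(w)`. [cite: Moore1966, §3] -/
theorem dLo_le {whi : ℚ} {w : ℝ} (hw0 : 0 ≤ w) (hw1 : w < 1) (hle : w ≤ (whi : ℝ)) :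
    ((dLo whi : ℚ) : ℝ) ≤ Dr w := by
  unfold dLo
  split_ifs with h
  · push_cast; exact Dr_nonneg w
  · have hwhi : (whi : ℝ) ^ 2 < 1 := by
      have : ¬ (1 : ℝ) ≤ (whi : ℝ) ^ 2 := by exact_mod_cast h
      exact lt_of_not_ge this
    have hx : 0 < 1 - w ^ 2 := by nlinarith
    have hxq : 1 - (whi : ℝ) ^ 2 ≤ 1 - w ^ 2 := by nlinarith
    have hxq0 : 0 < 1 - (whi : ℝ) ^ 2 := by linarith
    push_cast
    refine le_trans (ladderSqrtDown_mul_le_arccos δ NLAD _) ?_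
    unfold Dr
    apply Real.arccos_le_arccos
    push_cast
    apply Real.le_sqrt_of_sq_le
    have hs : √(1 - w ^ 2) ^ 2 = 1 - w ^ 2 := Real.sq_sqrt hx.le
    rw [div_pow, mul_pow, hs, div_le_div_iff₀ (by positivity) (by positivity)]
    nlinarith

/-- On the box: `1/2 − ww' ≤ n_hi`, `0 < r r'`, `(r r')² ≤ d2_hi`. [folklore] -/
private theorem box_facts {lj hj lk hk : ℚ} {w w' : ℝ} (hlj : 0 ≤ (lj : ℝ)) (hlk : 0 ≤ (lk : ℝ))
    (hw : 1 / 2 < w ∧ w < 1) (hw' : 1 / 2 < w' ∧ w' < 1)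
    (hbj : (lj : ℝ) ≤ w ∧ w ≤ hj) (hbk : (lk : ℝ) ≤ w' ∧ w' ≤ hk) :
    1 / 2 - w * w' ≤ ((nHi lj lk : ℚ) : ℝ) ∧ 0 < √(1 - w ^ 2) * √(1 - w' ^ 2) ∧
      (√(1 - w ^ 2) * √(1 - w' ^ 2)) ^ 2 ≤ ((d2Hi lj lk : ℚ) : ℝ) := by
  have hxj0 : 0 < 1 - w ^ 2 := by nlinarith [hw.1, hw.2]
  have hxk0 : 0 < 1 - w' ^ 2 := by nlinarith [hw'.1, hw'.2]
  have hprod : (√(1 - w ^ 2) * √(1 - w' ^ 2)) ^ 2 = (1 - w ^ 2) * (1 - w' ^ 2) := by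
    rw [mul_pow, Real.sq_sqrt hxj0.le, Real.sq_sqrt hxk0.le]
  refine ⟨?_, mul_pos (Real.sqrt_pos.2 hxj0) (Real.sqrt_pos.2 hxk0), ?_⟩
  · have : ((nHi lj lk : ℚ) : ℝ) = 1 / 2 - (lj : ℝ) * lk := by unfold nHi; push_cast; ring
    rw [this]
    nlinarith [mul_le_mul hbj.1 hbk.1 hlk (by linarith [hw.1])]
  · have : ((d2Hi lj lk : ℚ) : ℝ) = (1 - (lj : ℝ) ^ 2) * (1 - (lk : ℝ) ^ 2) := by
      unfold d2Hi; push_cast; ring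
    rw [hprod, this]
    have h1 : 1 - w ^ 2 ≤ 1 - (lj : ℝ) ^ 2 := by nlinarith
    have h2 : 1 - w' ^ 2 ≤ 1 - (lk : ℝ) ^ 2 := by nlinarith
    exact mul_le_mul h1 h2 hxk0.le (by linarith)

/-- On a box with `hk ≤ 1`: `d2_lo ≤ (r r')²` (`(1 − hj²)(1 − hk²) ≤ (1 − w²)(1 − hk²) ≤ (1 − w²)(1 − w'²)`).
[folklore] -/
private theorem d2Lo_le {hj hk : ℚ} {w w' : ℝ} (hw : 1 / 2 < w ∧ w < 1) (hw' : 1 / 2 < w' ∧ w' < 1)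
    (hbj : w ≤ hj) (hbk : w' ≤ hk) (hk1 : (hk : ℝ) ≤ 1) :
    ((d2Lo hj hk : ℚ) : ℝ) ≤ (√(1 - w ^ 2) * √(1 - w' ^ 2)) ^ 2 := by
  have hxj0 : 0 < 1 - w ^ 2 := by nlinarith [hw.1, hw.2]
  have hxk0 : 0 < 1 - w' ^ 2 := by nlinarith [hw'.1, hw'.2]
  have hprod : (√(1 - w ^ 2) * √(1 - w' ^ 2)) ^ 2 = (1 - w ^ 2) * (1 - w' ^ 2) := by
    rw [mul_pow, Real.sq_sqrt hxj0.le, Real.sq_sqrt hxk0.le]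
  have : ((d2Lo hj hk : ℚ) : ℝ) = (1 - (hj : ℝ) ^ 2) * (1 - (hk : ℝ) ^ 2) := by
    unfold d2Lo; push_cast; ring
  rw [hprod, this]
  have h1 : 1 - (hj : ℝ) ^ 2 ≤ 1 - w ^ 2 := by nlinarith [hw.1]
  have h2 : 1 - (hk : ℝ) ^ 2 ≤ 1 - w' ^ 2 := by nlinarith [hw'.1]
  have hk0 : 0 ≤ 1 - (hk : ℝ) ^ 2 := by nlinarith [hw'.1]
  exact mul_le_mul h1 h2 hk0 hxj0.le

/-- **Soundness of `aInf`**: the flagged box contains no pair of northern points with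
`cos ≥ −1`. [cite: Moore1966, §3] -/
theorem aInf_sound {lj hj lk hk : ℚ} {w w' : ℝ} (h : aInf lj lk = true)
    (hw : 1 / 2 < w ∧ w < 1) (hw' : 1 / 2 < w' ∧ w' < 1)
    (hbj : (lj : ℝ) ≤ w ∧ w ≤ hj) (hbk : (lk : ℝ) ≤ w' ∧ w' ≤ hk) (hc : -1 ≤ cr w w') : False := by
  unfold aInf at h
  simp only [Bool.and_eq_true, decide_eq_true_eq] at h
  obtain ⟨⟨⟨⟨hlj, hlk⟩, hn⟩, hd⟩, hnd⟩ := h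
  have hljR : (0 : ℝ) ≤ lj := by exact_mod_cast hlj
  have hlkR : (0 : ℝ) ≤ lk := by exact_mod_cast hlk
  obtain ⟨hnum, hdpos, hd2⟩ := box_facts hljR hlkR hw hw' hbj hbk
  have hnR : ((nHi lj lk : ℚ) : ℝ) < 0 := by exact_mod_cast hn
  have hndR : ((d2Hi lj lk : ℚ) : ℝ) < ((nHi lj lk : ℚ) : ℝ) ^ 2 := by exact_mod_cast hnd
  set n : ℝ := ((nHi lj lk : ℚ) : ℝ)
  set D2 : ℝ := ((d2Hi lj lk : ℚ) : ℝ)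
  set d := √(1 - w ^ 2) * √(1 - w' ^ 2)
  -- `cr ≤ n/d` and `(n/d)² > 1` with `n/d < 0`, so `cr < −1`
  have hcr : cr w w' ≤ n / d := div_le_div_of_nonneg_right hnum hdpos.le
  have hd2' : d ^ 2 < n ^ 2 := lt_of_le_of_lt hd2 hndR
  have hlt : n / d < -1 := by
    rw [div_lt_iff₀ hdpos]
    nlinarith [hdpos, hnR]
  linarith

/-- **Soundness of `aVal`**: on the box, `aVal ≤ A(w, w')`. [cite: Moore1966, §3] -/
theorem aVal_le {lj hj lk hk : ℚ} {w w' : ℝ}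
    (hw : 1 / 2 < w ∧ w < 1) (hw' : 1 / 2 < w' ∧ w' < 1)
    (hbj : (lj : ℝ) ≤ w ∧ w ≤ hj) (hbk : (lk : ℝ) ≤ w' ∧ w' ≤ hk) :
    ((aVal lj hj lk hk : ℚ) : ℝ) ≤ Ar w w' := by
  have hA0 : 0 ≤ Ar w w' := Ar_nonneg _ _
  unfold aVal
  by_cases c1 : 0 ≤ lj ∧ 0 ≤ lk ∧ nHi lj lk ≤ 0 ∧ 0 < d2Hi lj lk ∧ nHi lj lk ^ 2 ≤ d2Hi lj lk
  · rw [if_pos c1]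
    obtain ⟨hlj, hlk, hn, hd, hnd⟩ := c1
    have hljR : (0 : ℝ) ≤ lj := by exact_mod_cast hlj
    have hlkR : (0 : ℝ) ≤ lk := by exact_mod_cast hlk
    obtain ⟨hnum, hdpos, hd2⟩ := box_facts hljR hlkR hw hw' hbj hbk
    have hnR : ((nHi lj lk : ℚ) : ℝ) ≤ 0 := by exact_mod_cast hn
    have hdR : (0 : ℝ) < ((d2Hi lj lk : ℚ) : ℝ) := by exact_mod_cast hd
    have hcastρ : (((nHi lj lk ^ 2 / d2Hi lj lk : ℚ)) : ℝ) =
        ((nHi lj lk : ℚ) : ℝ) ^ 2 / ((d2Hi lj lk : ℚ) : ℝ) := by push_cast; ring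
    set n : ℝ := ((nHi lj lk : ℚ) : ℝ) with hn_def
    set D2 : ℝ := ((d2Hi lj lk : ℚ) : ℝ) with hD2_def
    set d := √(1 - w ^ 2) * √(1 - w' ^ 2) with hd_def
    -- `cr ≤ n/d ≤ n/√D2 = −√(n²/D2)`
    have hdle : d ≤ √D2 := Real.le_sqrt_of_sq_le hd2
    have hsD2 : 0 < √D2 := Real.sqrt_pos.2 hdR
    have hcr1 : cr w w' ≤ n / d := div_le_div_of_nonneg_right hnum hdpos.le
    have hcr2 : n / d ≤ n / √D2 := by
      rw [div_le_div_iff₀ hdpos hsD2]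
      exact mul_le_mul_of_nonpos_left hdle hnR
    have hρ : n / √D2 = -√(n ^ 2 / D2) := by
      rw [Real.sqrt_div' _ hdR.le, Real.sqrt_sq_eq_abs, abs_of_nonpos hnR]
      ring
    have hcr : cr w w' ≤ -√(((nHi lj lk ^ 2 / d2Hi lj lk : ℚ) : ℝ)) := by
      rw [hcastρ, ← hρ]; exact hcr1.trans hcr2
    -- `arccos cr ≥ arccos (−√ρ) = π − arccos √ρ ≥ PILO − ladderSqrtUp`
    have h1 : arccos (-√(((nHi lj lk ^ 2 / d2Hi lj lk : ℚ) : ℝ))) ≤ Ar w w' :=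
      Real.arccos_le_arccos hcr
    rw [Real.arccos_neg] at h1
    have h2 := arccos_le_ladderSqrtUp_mul (arccosSqrtLeB_NLAD (nHi lj lk ^ 2 / d2Hi lj lk))
    push_cast
    linarith [PILO_le]
  · rw [if_neg c1]
    by_cases c2 : 0 ≤ lj ∧ 0 ≤ lk ∧ 0 < nHi lj lk ∧ hj ≤ 1 ∧ hk ≤ 1 ∧ 0 < d2Lo hj hk
    · rw [if_pos c2]
      obtain ⟨hlj, hlk, hn, -, hk1, hd⟩ := c2
      have hljR : (0 : ℝ) ≤ lj := by exact_mod_cast hlj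
      have hlkR : (0 : ℝ) ≤ lk := by exact_mod_cast hlk
      have hk1R : (hk : ℝ) ≤ 1 := by exact_mod_cast hk1
      obtain ⟨hnum, hdpos, -⟩ := box_facts hljR hlkR hw hw' hbj hbk
      have hd2 := d2Lo_le hw hw' hbj.2 hbk.2 hk1R
      have hnR : (0 : ℝ) < ((nHi lj lk : ℚ) : ℝ) := by exact_mod_cast hn
      have hdR : (0 : ℝ) < ((d2Lo hj hk : ℚ) : ℝ) := by exact_mod_cast hd
      have hcastρ : (((nHi lj lk ^ 2 / d2Lo hj hk : ℚ)) : ℝ) =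
          ((nHi lj lk : ℚ) : ℝ) ^ 2 / ((d2Lo hj hk : ℚ) : ℝ) := by push_cast; ring
      set n : ℝ := ((nHi lj lk : ℚ) : ℝ) with hn_def
      set D2 : ℝ := ((d2Lo hj hk : ℚ) : ℝ) with hD2_def
      set d := √(1 - w ^ 2) * √(1 - w' ^ 2) with hd_def
      have hsD2 : 0 < √D2 := Real.sqrt_pos.2 hdR
      have hdle : √D2 ≤ d := by
        rw [show d = √(d ^ 2) from (Real.sqrt_sq hdpos.le).symm]
        exact Real.sqrt_le_sqrt hd2
      have hcr1 : cr w w' ≤ n / d := div_le_div_of_nonneg_right hnum hdpos.le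
      have hcr2 : n / d ≤ n / √D2 := div_le_div_of_nonneg_left hnR.le hsD2 hdle
      have hρ : n / √D2 = √(n ^ 2 / D2) := by
        rw [Real.sqrt_div' _ hdR.le, Real.sqrt_sq hnR.le]
      have hcr : cr w w' ≤ √(((nHi lj lk ^ 2 / d2Lo hj hk : ℚ) : ℝ)) := by
        rw [hcastρ, ← hρ]; exact hcr1.trans hcr2
      have h1 := Real.arccos_le_arccos hcr
      have h2 := ladderSqrtDown_mul_le_arccos δ NLAD (nHi lj lk ^ 2 / d2Lo hj hk)
      push_cast
      unfold Ar
      linarith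
    · rw [if_neg c2]; push_cast; exact hA0

/-- **Soundness of `walk`**: rational walk bounds are below the real walk bounds. [folklore] -/
private theorem walk_le {Da Db : ℚ} {Dra Drb : ℝ} (ha : ((Da : ℚ) : ℝ) ≤ Dra) (hb : ((Db : ℚ) : ℝ) ≤ Drb)
    (m : ℕ) : ((walk Da Db m G0 : ℚ) : ℝ) ≤ walkR Dra Drb m Gr := by
  unfold walk walkR
  by_cases hm : m = 0
  · simp [hm]
  · rw [if_neg hm, if_neg hm]
    have hm1 : 1 ≤ m := Nat.one_le_iff_ne_zero.2 hm
    have hcast : (((m - 1 : ℕ) : ℚ) : ℝ) = (m : ℝ) - 1 := by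
      push_cast [Nat.cast_sub hm1]; ring
    push_cast
    rw [Nat.cast_sub hm1, Nat.cast_one]
    have hm0 : (0 : ℝ) ≤ (m : ℝ) - 1 := by
      have : (1 : ℝ) ≤ m := by exact_mod_cast hm1
      linarith
    have hG := mul_le_mul_of_nonneg_left G0_le hm0
    linarith

/-! #### Soundness of the covers and of the branch and bound -/

/-- Splitting a box keeps every point in one of the halves. [folklore] -/
private theorem Box.mem_split {b : Box} {w₁ w₂ w₃ : ℝ} (h : b.mem w₁ w₂ w₃) :
    b.split.1.mem w₁ w₂ w₃ ∨ b.split.2.mem w₁ w₂ w₃ := by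
  obtain ⟨h1, h2, h3, h4, h5, h6⟩ := h
  unfold Box.split
  split_ifs with c1 c2
  · rcases le_total w₁ (((b.l1 + b.h1) / 2 : ℚ) : ℝ) with hle | hle
    · left; exact ⟨h1, hle, h3, h4, h5, h6⟩
    · right; exact ⟨hle, h2, h3, h4, h5, h6⟩
  · rcases le_total w₂ (((b.l2 + b.h2) / 2 : ℚ) : ℝ) with hle | hle
    · left; exact ⟨h1, h2, h3, hle, h5, h6⟩
    · right; exact ⟨h1, h2, hle, h4, h5, h6⟩
  · rcases le_total w₃ (((b.l3 + b.h3) / 2 : ℚ) : ℝ) with hle | hle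
    · left; exact ⟨h1, h2, h3, h4, h5, hle⟩
    · right; exact ⟨h1, h2, h3, h4, hle, h6⟩

section Sound

variable {m1 m2 m3 : ℕ} {b : Box} {w₁ w₂ w₃ Φ₁ Φ₂ Φ₃ : ℝ}

/-- The certified `D`'s and `A`'s are below the real ones on the box. [folklore] -/
private theorem bounds_of_mem (hb : b.mem w₁ w₂ w₃) (hw₁ : 1 / 2 < w₁ ∧ w₁ < 1)
    (hw₂ : 1 / 2 < w₂ ∧ w₂ < 1) (hw₃ : 1 / 2 < w₃ ∧ w₃ < 1) :
    ((b.D1 : ℚ) : ℝ) ≤ Dr w₁ ∧ ((b.D2 : ℚ) : ℝ) ≤ Dr w₂ ∧ ((b.D3 : ℚ) : ℝ) ≤ Dr w₃ ∧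
      ((b.A12 : ℚ) : ℝ) ≤ Ar w₁ w₂ ∧ ((b.A23 : ℚ) : ℝ) ≤ Ar w₂ w₃ ∧ ((b.A31 : ℚ) : ℝ) ≤ Ar w₃ w₁ := by
  obtain ⟨h1, h2, h3, h4, h5, h6⟩ := hb
  exact ⟨dLo_le (by linarith [hw₁.1]) hw₁.2 h2, dLo_le (by linarith [hw₂.1]) hw₂.2 h4,
    dLo_le (by linarith [hw₃.1]) hw₃.2 h6, aVal_le hw₁ hw₂ ⟨h1, h2⟩ ⟨h3, h4⟩,
    aVal_le hw₂ hw₃ ⟨h3, h4⟩ ⟨h5, h6⟩, aVal_le hw₃ hw₁ ⟨h5, h6⟩ ⟨h1, h2⟩⟩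

/-- An infeasible box contains no configuration. [folklore] -/
private theorem infeasible_sound (h : b.infeasible = true) (hb : b.mem w₁ w₂ w₃)
    (hw₁ : 1 / 2 < w₁ ∧ w₁ < 1) (hw₂ : 1 / 2 < w₂ ∧ w₂ < 1) (hw₃ : 1 / 2 < w₃ ∧ w₃ < 1)
    (hc₁₂ : -1 ≤ cr w₁ w₂) (hc₂₃ : -1 ≤ cr w₂ w₃) (hc₃₁ : -1 ≤ cr w₃ w₁) : False := by
  obtain ⟨h1, h2, h3, h4, h5, h6⟩ := hb
  unfold Box.infeasible at h
  simp only [Bool.or_eq_true] at h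
  rcases h with (h | h) | h
  · exact aInf_sound h hw₁ hw₂ ⟨h1, h2⟩ ⟨h3, h4⟩ hc₁₂
  · exact aInf_sound h hw₂ hw₃ ⟨h3, h4⟩ ⟨h5, h6⟩ hc₂₃
  · exact aInf_sound h hw₃ hw₁ ⟨h5, h6⟩ ⟨h1, h2⟩ hc₃₁

/-- **Soundness of `crudeViolated`.** [cite: Kertesz1994, proof (relative longitudes)] -/
theorem crudeViolated_sound (h : crudeViolated m1 m2 m3 b = true) (hb : b.mem w₁ w₂ w₃)
    (H : CrudeHyps m1 m2 m3 w₁ w₂ w₃ Φ₁ Φ₂ Φ₃) : False := by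
  have h2π := two_pi_lt
  obtain ⟨hD1, hD2, hD3, hA12, hA23, hA31⟩ := bounds_of_mem hb H.hw₁ H.hw₂ H.hw₃
  -- real versions of the sector bounds
  have hS1 : ((b.S1 m1 : ℚ) : ℝ) ≤ Φ₁ := by
    unfold Box.S1; push_cast
    exact max_le (hA12.trans H.jump₁) ((walk_le hD1 hD2 m1).trans H.walk₁)
  have hS2 : ((b.S2 m2 : ℚ) : ℝ) ≤ Φ₂ := by
    unfold Box.S2; push_cast
    exact max_le (hA23.trans H.jump₂) ((walk_le hD2 hD3 m2).trans H.walk₂)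
  have hS3 : ((b.S3 m3 : ℚ) : ℝ) ≤ Φ₃ := by
    unfold Box.S3; push_cast
    exact max_le (hA31.trans H.jump₃) ((walk_le hD3 hD1 m3).trans H.walk₃)
  have hM12 : ((max b.A12 (walk b.D2 b.D1 (m2 + m3) G0) : ℚ) : ℝ) ≤ Φ₂ + Φ₃ := by
    push_cast; exact max_le (hA12.trans H.jump₁') ((walk_le hD2 hD1 _).trans H.walk₁')
  have hM23 : ((max b.A23 (walk b.D3 b.D2 (m3 + m1) G0) : ℚ) : ℝ) ≤ Φ₃ + Φ₁ := by
    push_cast; exact max_le (hA23.trans H.jump₂') ((walk_le hD3 hD2 _).trans H.walk₂')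
  have hM31 : ((max b.A31 (walk b.D1 b.D3 (m1 + m2) G0) : ℚ) : ℝ) ≤ Φ₁ + Φ₂ := by
    push_cast; exact max_le (hA31.trans H.jump₃') ((walk_le hD1 hD3 _).trans H.walk₃')
  have hsum := H.hsum
  have hG := G0_le
  unfold crudeViolated at h
  simp only [Bool.or_eq_true, decide_eq_true_eq] at h
  rcases h with ((((((h | h) | h) | h) | h) | h) | h) | h
  · exact infeasible_sound h hb H.hw₁ H.hw₂ H.hw₃ H.hc₁₂ H.hc₂₃ H.hc₃₁
  · have h' : ((TWOPIHI : ℚ) : ℝ) < ((b.T3 m1 m2 m3 : ℚ) : ℝ) := by exact_mod_cast h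
    unfold Box.T3 at h'; push_cast at h'
    linarith
  · have h' : ((TWOPIHI : ℚ) : ℝ) < ((b.T12 m1 m2 m3 : ℚ) : ℝ) := by exact_mod_cast h
    unfold Box.T12 at h'; push_cast at h' hM12
    linarith
  · have h' : ((TWOPIHI : ℚ) : ℝ) < ((b.T23 m1 m2 m3 : ℚ) : ℝ) := by exact_mod_cast h
    unfold Box.T23 at h'; push_cast at h' hM23
    linarith
  · have h' : ((TWOPIHI : ℚ) : ℝ) < ((b.T31 m1 m2 m3 : ℚ) : ℝ) := by exact_mod_cast h
    unfold Box.T31 at h'; push_cast at h' hM31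
    linarith
  · have h' : ((TWOPIHI : ℚ) : ℝ) < ((b.O1 : ℚ) : ℝ) := by exact_mod_cast h
    unfold Box.O1 at h'; push_cast at h'
    linarith [H.full₁]
  · have h' : ((TWOPIHI : ℚ) : ℝ) < ((b.O2 : ℚ) : ℝ) := by exact_mod_cast h
    unfold Box.O2 at h'; push_cast at h'
    linarith [H.full₂]
  · have h' : ((TWOPIHI : ℚ) : ℝ) < ((b.O3 : ℚ) : ℝ) := by exact_mod_cast h
    unfold Box.O3 at h'; push_cast at h'
    linarith [H.full₃]

/-- **Soundness of `sixtyViolated`.** [cite: Kertesz1994, proof (relative longitudes)] -/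
theorem sixtyViolated_sound (h : sixtyViolated b = true) (hb : b.mem w₁ w₂ w₃)
    (H : SixtyHyps w₁ w₂ w₃ Φ₁ Φ₂ Φ₃) : False := by
  have h2π := two_pi_lt
  have hw₁ : 1 / 2 < w₁ ∧ w₁ < 1 := ⟨by linarith [H.hw₁.1], by linarith [H.hw₁.2]⟩
  have hw₂ : 1 / 2 < w₂ ∧ w₂ < 1 := ⟨by linarith [H.hw₂.1], by linarith [H.hw₂.2]⟩
  have hw₃ : 1 / 2 < w₃ ∧ w₃ < 1 := ⟨by linarith [H.hw₃.1], by linarith [H.hw₃.2]⟩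
  obtain ⟨hD1, hD2, hD3, hA12, hA23, hA31⟩ := bounds_of_mem hb hw₁ hw₂ hw₃
  have hP := PI3_le
  unfold sixtyViolated at h
  simp only [Bool.or_eq_true, decide_eq_true_eq] at h
  rcases h with h | h
  · exact infeasible_sound h hb hw₁ hw₂ hw₃ H.hc₁₂ H.hc₂₃ H.hc₃₁
  · have h' : ((TWOPIHI : ℚ) : ℝ) < ((b.T60 : ℚ) : ℝ) := by exact_mod_cast h
    unfold Box.T60 at h'; push_cast at h'
    have e1 : max ((b.A12 : ℚ) : ℝ) ((b.D1 : ℝ) + b.D2 + PI3) ≤ Φ₁ :=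
      max_le (hA12.trans H.jump₁) (by linarith [H.walk₁])
    have e2 : max ((b.A23 : ℚ) : ℝ) ((b.D2 : ℝ) + b.D3 + PI3) ≤ Φ₂ :=
      max_le (hA23.trans H.jump₂) (by linarith [H.walk₂])
    have e3 : max ((b.A31 : ℚ) : ℝ) ((b.D3 : ℝ) + b.D1 + PI3) ≤ Φ₃ :=
      max_le (hA31.trans H.jump₃) (by linarith [H.walk₃])
    linarith [H.hsum]

/-- **Soundness of `bnbCrude`.** [cite: Moore1966, §3] -/
theorem bnbCrude_sound : ∀ (fuel : ℕ) (b : Box), bnbCrude m1 m2 m3 fuel b = true →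
    ∀ {w₁ w₂ w₃ Φ₁ Φ₂ Φ₃ : ℝ}, b.mem w₁ w₂ w₃ → CrudeHyps m1 m2 m3 w₁ w₂ w₃ Φ₁ Φ₂ Φ₃ → False
  | 0, b, h => by simp [bnbCrude] at h
  | fuel + 1, b, h => by
    intro hb H
    simp only [bnbCrude, Bool.or_eq_true, Bool.and_eq_true] at h
    rcases h with h | ⟨h1, h2⟩
    · exact crudeViolated_sound h hb H
    · rcases Box.mem_split hb with hb' | hb'
      · exact bnbCrude_sound fuel _ h1 hb' H
      · exact bnbCrude_sound fuel _ h2 hb' H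

/-- Real cube membership from `Box.inCube`. [folklore] -/
private theorem inCube_sound (h : b.inCube = true) (hb : b.mem w₁ w₂ w₃) :
    (0.8138 ≤ w₁ ∧ w₁ ≤ 0.8192) ∧ (0.8138 ≤ w₂ ∧ w₂ ≤ 0.8192) ∧ (0.8138 ≤ w₃ ∧ w₃ ≤ 0.8192) := by
  obtain ⟨h1, h2, h3, h4, h5, h6⟩ := hb
  unfold Box.inCube at h
  simp only [Bool.and_eq_true, decide_eq_true_eq] at h
  obtain ⟨⟨⟨⟨⟨c1, c2⟩, c3⟩, c4⟩, c5⟩, c6⟩ := h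
  have c1' : (0.8138 : ℝ) ≤ (b.l1 : ℝ) := by
    have : ((8138 / 10000 : ℚ) : ℝ) ≤ (b.l1 : ℝ) := by exact_mod_cast c1
    norm_num at this; linarith
  have c2' : (b.h1 : ℝ) ≤ 0.8192 := by
    have : (b.h1 : ℝ) ≤ ((8192 / 10000 : ℚ) : ℝ) := by exact_mod_cast c2
    norm_num at this; linarith
  have c3' : (0.8138 : ℝ) ≤ (b.l2 : ℝ) := by
    have : ((8138 / 10000 : ℚ) : ℝ) ≤ (b.l2 : ℝ) := by exact_mod_cast c3
    norm_num at this; linarith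
  have c4' : (b.h2 : ℝ) ≤ 0.8192 := by
    have : (b.h2 : ℝ) ≤ ((8192 / 10000 : ℚ) : ℝ) := by exact_mod_cast c4
    norm_num at this; linarith
  have c5' : (0.8138 : ℝ) ≤ (b.l3 : ℝ) := by
    have : ((8138 / 10000 : ℚ) : ℝ) ≤ (b.l3 : ℝ) := by exact_mod_cast c5
    norm_num at this; linarith
  have c6' : (b.h3 : ℝ) ≤ 0.8192 := by
    have : (b.h3 : ℝ) ≤ ((8192 / 10000 : ℚ) : ℝ) := by exact_mod_cast c6
    norm_num at this; linarith
  exact ⟨⟨by linarith, by linarith⟩, ⟨by linarith, by linarith⟩, ⟨by linarith, by linarith⟩⟩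

/-- **Soundness of `bnbSixty`.** [cite: Moore1966, §3] -/
theorem bnbSixty_sound : ∀ (fuel : ℕ) (b : Box), bnbSixty fuel b = true →
    ∀ {w₁ w₂ w₃ Φ₁ Φ₂ Φ₃ : ℝ}, b.mem w₁ w₂ w₃ → SixtyHyps w₁ w₂ w₃ Φ₁ Φ₂ Φ₃ →
      (0.8138 ≤ w₁ ∧ w₁ ≤ 0.8192) ∧ (0.8138 ≤ w₂ ∧ w₂ ≤ 0.8192) ∧ (0.8138 ≤ w₃ ∧ w₃ ≤ 0.8192)
  | 0, b, h => by simp [bnbSixty] at h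
  | fuel + 1, b, h => by
    intro hb H
    simp only [bnbSixty, Bool.or_eq_true, Bool.and_eq_true] at h
    rcases h with (h | h) | ⟨h1, h2⟩
    · exact inCube_sound h hb
    · exact (sixtyViolated_sound h hb H).elim
    · rcases Box.mem_split hb with hb' | hb'
      · exact bnbSixty_sound fuel _ h1 hb' H
      · exact bnbSixty_sound fuel _ h2 hb' H

end Sound

/-! #### Consequences of the run -/

/-- The three parts of `allChecks`. [folklore] -/
private theorem checks :
    (compositions.all fun t => bnbCrude t.1 t.2.1 t.2.2 40 root) = true ∧
    (windowBoxes.all fun b => bnbCrude 2 2 2 40 b) = true ∧ bnbSixty 40 windowBox = true := by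
  have h := allChecks_eq_true
  unfold allChecks at h
  simp only [Bool.and_eq_true] at h
  exact ⟨h.1.1, h.1.2, h.2⟩

/-- **Only the composition `(2,2,2)` survives the crude budget.**  For `m₁ + m₂ + m₃ = 6` with
`(m₁, m₂, m₃) ≠ (2,2,2)` the crude hypotheses are contradictory.
[cite: Kertesz1994, proof (relative longitudes: one northern point in every second low gap)] -/
theorem crude_pattern {m1 m2 m3 : ℕ} (hm : m1 + m2 + m3 = 6) (hne : (m1, m2, m3) ≠ (2, 2, 2))
    {w₁ w₂ w₃ Φ₁ Φ₂ Φ₃ : ℝ} (H : CrudeHyps m1 m2 m3 w₁ w₂ w₃ Φ₁ Φ₂ Φ₃) : False := by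
  have hmem : (m1, m2, m3) ∈ compositions := by
    unfold compositions
    simp only [List.mem_filter, List.mem_flatMap, List.mem_map, List.mem_range, decide_eq_true_eq]
    refine ⟨⟨m1, by omega, m2, by omega, ?_⟩, hne⟩
    simp only [Prod.mk.injEq, true_and]
    omega
  have hall := checks.1
  rw [List.all_eq_true] at hall
  have h := hall _ hmem
  refine bnbCrude_sound 40 root h ?_ H
  unfold root Box.mem
  push_cast
  refine ⟨?_, ?_, ?_, ?_, ?_, ?_⟩ <;> linarith [H.hw₁.1, H.hw₁.2, H.hw₂.1, H.hw₂.2, H.hw₃.1, H.hw₃.2]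

/-- **The crude window**: under the crude budget with composition `(2,2,2)` every northern
height lies in `(0.78, 0.84)` (colatitude between `32.9°` and `38.7°`; Kertész's printed window is
latitude in `(45°, 60°)`). [cite: Kertesz1994, proof ("latitude greater than 45° and less than 60°")] -/
theorem crude_window {w₁ w₂ w₃ Φ₁ Φ₂ Φ₃ : ℝ} (H : CrudeHyps 2 2 2 w₁ w₂ w₃ Φ₁ Φ₂ Φ₃) :
    (0.78 < w₁ ∧ w₁ < 0.84) ∧ (0.78 < w₂ ∧ w₂ < 0.84) ∧ (0.78 < w₃ ∧ w₃ < 0.84) := by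
  have hall := checks.2.1
  unfold windowBoxes at hall
  simp only [List.all_cons, List.all_nil, Bool.and_true, Bool.and_eq_true] at hall
  obtain ⟨c1, c2, c3, c4, c5, c6⟩ := hall
  have b1 := H.hw₁; have b2 := H.hw₂; have b3 := H.hw₃
  have m : ∀ {bx : Box}, bnbCrude 2 2 2 40 bx = true → bx.mem w₁ w₂ w₃ → False :=
    fun h hb => bnbCrude_sound 40 _ h hb H
  refine ⟨⟨?_, ?_⟩, ⟨?_, ?_⟩, ⟨?_, ?_⟩⟩
  · by_contra hx; push Not at hx
    exact m c1 (by unfold Box.mem; push_cast; refine ⟨?_, ?_, ?_, ?_, ?_, ?_⟩ <;> linarith)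
  · by_contra hx; push Not at hx
    exact m c2 (by unfold Box.mem; push_cast; refine ⟨?_, ?_, ?_, ?_, ?_, ?_⟩ <;> linarith)
  · by_contra hx; push Not at hx
    exact m c3 (by unfold Box.mem; push_cast; refine ⟨?_, ?_, ?_, ?_, ?_, ?_⟩ <;> linarith)
  · by_contra hx; push Not at hx
    exact m c4 (by unfold Box.mem; push_cast; refine ⟨?_, ?_, ?_, ?_, ?_, ?_⟩ <;> linarith)
  · by_contra hx; push Not at hx
    exact m c5 (by unfold Box.mem; push_cast; refine ⟨?_, ?_, ?_, ?_, ?_, ?_⟩ <;> linarith)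
  · by_contra hx; push Not at hx
    exact m c6 (by unfold Box.mem; push_cast; refine ⟨?_, ?_, ?_, ?_, ?_, ?_⟩ <;> linarith)

/-- **The `z = 0` budget pins the northern heights into the cube** `[0.8138, 0.8192]³` around
`w* = √6/3 = 0.8165` (where `KerteszLocalRigidity.kertesz_local_rigidity` takes over).
[cite: Kertesz1994, proof ("the latitudes … are completely determined")] -/
theorem sixty_cube {w₁ w₂ w₃ Φ₁ Φ₂ Φ₃ : ℝ} (H : SixtyHyps w₁ w₂ w₃ Φ₁ Φ₂ Φ₃) :
    (0.8138 ≤ w₁ ∧ w₁ ≤ 0.8192) ∧ (0.8138 ≤ w₂ ∧ w₂ ≤ 0.8192) ∧ (0.8138 ≤ w₃ ∧ w₃ ≤ 0.8192) := by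
  refine bnbSixty_sound 40 windowBox checks.2.2 ?_ H
  unfold windowBox Box.mem
  push_cast
  refine ⟨?_, ?_, ?_, ?_, ?_, ?_⟩ <;>
    linarith [H.hw₁.1, H.hw₁.2, H.hw₂.1, H.hw₂.2, H.hw₃.1, H.hw₃.2]

end

end KerteszCert

end Literature.Geometry.DiscreteGeometry
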